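import Summits.QuantumFields.YangMills.Theorems.AlphaInputsT3ACv3
import HarnessLib

/-!
# `AlphaInputsT3ACv3Data` — THE VERSION-3 PACKAGE'S DATA ASSEMBLED INTO THE INTERFACE'S `AlphaDataT3`, WITH THE WINDOWED PINNED HISTORY SUM AS `LF`, AND EVERY
# v2-DELIVERED SCHEMA RE-DELIVERED FOR IT (owner RULING g18-№3 §3: «reuse all mass-free/size rows verbatim») — lane `pub-balaban3d`, seat alpha-1 (g3)

THE DATUM `OfV3At.dataT3v3`: `OfV2At.dataT3c`'s field table VERBATIM at the v3 record `h.pkgAtV3 hc γ hγ hγ1 K` (histories/regions the lane's, `Adm := ChargedT3` = print's (40)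
support, `Umin := U_k(·,h)`, `mainT`/`Pint`/`Zterm`/`χ`/`Estep`/`Rm` the AC tower's, `Ecst K j := E_j − E`, polymer fields the parameter `π`) EXCEPT
`LF K j W Φ := Σ_h wtP_j(h, W)·e^{Φ h}` — the history sum with print's WINDOWED PINNED weights (`PkgAtV3.wtP`: `wt(triv) = 1` at `j = 0`,
`wt_{k+1}(h′) = 𝟙[(40)-window_{k+1}(h′)]·M_{k+1}(h′)`, `M` the pinned masses, `M(triv) ≡ 1`), for which (41) holds `dV`-a.e. at every `j ≤ K` from the v3 rows alone
(`PkgAtV3.resDensity_le_sum_ae`).  So for THIS datum `up_j = Σ_h wtP_j(h)·exp(−mainT_j(h) + Pint_j(h) + Zterm_j(h))` has nonnegative weights supported in `Adm` with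
`∫ wt ≤ 1` uniformly in the cut-off (`AlphaInputsT3ACv3Histories`), and no transported trivial mass appears anywhere.

DELIVERED (all PROVED for `dataT3v3`, proofs = the v2 ones at the v3 record): `Constraint42Top`, `Regularity68Levels`/`Regularity68`, `MainTermIsAction`, the
`UminTrivIsRegMinimiser` clauses at heights `n < K` under the [7] bookkeeping, `AdmOnSmall`, `Ineq41AE` ∧ `Ineq47AE` ∧ `EnvelopeRegular` at every `j ≤ K`, `ChiRange`,
`TrivRegions`, the `EcstBook` identity, `RmSize`, `χ_j = 𝟙[θBal(K − j)-small]`, `NoTrivOnLarge` clause 1, `0 < low_j` on the window, `0 < ∫ low_j`.  OPEN inputs: only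
`h : OfV3At F 𝔠 a₀ a₁` (hypothesis schema, never asserted).

References: T. Bałaban, Commun. Math. Phys. 102 (1985) 255–275 [Balaban1985UV3]; Commun. Math. Phys. 102 (1985) 277–309 [Balaban1985Variational].
-/

set_option autoImplicit false

noncomputable section

namespace Summit.QuantumFields.YangMills.Theorems

open MeasureTheory
open scoped BigOperators
open Literature.MathematicalPhysics.QuantumFieldTheory.Balaban1983to89
open Literature.MathematicalPhysics.QuantumFieldTheory.Balaban1983to89.T3ContinuumYM3Torus
open Literature.MathematicalPhysics.QuantumFieldTheory.Balaban1983to89.T3UnitLawDensityEML (ℰp)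
open Literature.MathematicalPhysics.QuantumFieldTheory.Balaban1983to89.T3UnitScaleTilt (θBal)
open Literature.MathematicalPhysics.QuantumFieldTheory.Balaban1983to89.T3LevelShift (fieldShift)
open Literature.MathematicalPhysics.QuantumFieldTheory.Balaban1983to89.T3PrintedRegularMinimiser (regFibrePr minActionRegPr)
open Literature.MathematicalPhysics.QuantumFieldTheory.Balaban1983to89.T3AlphaInputsAC
open Literature.MathematicalPhysics.QuantumFieldTheory.Balaban1985CMP102
open Literature.MathematicalPhysics.QuantumFieldTheory.Balaban1985CMP102.Setting
open Summit.QuantumFields.Balaban3D.Carriers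
open Summit.QuantumFields.Balaban3D.Proofs.Primitives
open Summit.QuantumFields.Balaban3D.Proofs.TowerAC
open Summit.QuantumFields.Balaban3D.Proofs.StandardAC
open Summit.QuantumFields.Balaban3D.Proofs.InputsAC
open Summit.QuantumFields.Balaban3D.Proofs.TowerFactsAC
open Summit.QuantumFields.Balaban3D.Proofs.TransportAC (integrable_mul_exp_of_le)
open Summit.QuantumFields.Balaban3D.Proofs (Bound55Std.measurable_actionEta Bound55Std.actionEta_nonneg)

variable {F : T3Family} {𝔠 : AlphaConsts F.L (suGroupModel 2).N} {a₀ a₁ : ℝ}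

/-! ## §1 The datum -/

/-- **THE VERSION-3 PACKAGE'S DATA ASSEMBLED, WITH THE WINDOWED PINNED HISTORY SUM AS `LF`**: run-`K` fields := the objects of the AC tower of the chosen v3 record
`h.pkgAtV3 hc γ hγ hγ1 K` (`OfV2At.dataT3c`'s table), `Adm := ChargedT3` (print's (40) support), and `LF K j W Φ := Σ_h wtP_j(h, W)·e^{Φ h}` with the windowed pinned
weights `PkgAtV3.wtP`.  A DEFINITION (data assembled by classical choice from an open hypothesis); nothing is asserted by it. [cite: Balaban1985UV3, (38)–(43) p.266 + (47) p.267] -/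
def AlphaInputsT3AC.OfV3At.dataT3v3 (h : AlphaInputsT3AC.OfV3At F 𝔠 a₀ a₁) (hc : 0 < a₀ ∧ 0 < a₁ ∧ 𝔠.B₃ * a₁ ≤ a₀)
    (γ : ℝ) (hγ : 0 < γ) (hγ1 : γ ≤ (min 𝔠.gamma0 1) ^ 2) (π : AlphaInputsT3AC.PolymerT3 F) : AlphaDataT3 F γ where
  Hist := fun K j => Hist (F.P K) j
  triv := fun K j => Hist.triv (F.P K) j
  Ω := fun K j hh i => Omega 𝔠.lane.carrier.M₁
    (rcolOf (T3Scales F γ hγ (hγ1.trans (sq_min_one_le _ 𝔠.gamma0_pos)) K) 𝔠.lane.carrier) j hh i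
  Adm := fun K j hh W => ChargedT3 F γ 𝔠.b₀ 𝔠.p₀ (avgWindowFactor F.L) K 𝔠.lane.carrier.M₁
    (rcolOf (T3Scales F γ hγ (hγ1.trans (sq_min_one_le _ 𝔠.gamma0_pos)) K) 𝔠.lane.carrier) j hh W
  LF := fun K j W Φ => ∑ r : Hist (F.P K) j, (h.pkgAtV3 hc γ hγ hγ1 K).wtP j r W * Real.exp (Φ r)
  Umin := fun K j hh W => (h.pkgAtV3 hc γ hγ hγ1 K).UkH j hh W
  mainT := fun K j hh W => (h.pkgAtV3 hc γ hγ hγ1 K).T.mainT j hh W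
  Pint := fun K j hh W => (h.pkgAtV3 hc γ hγ hγ1 K).T.Pint j hh W
  Loc := π.Loc
  Pterm := π.Pterm
  enl := π.enl
  treeLen := π.treeLen
  Zterm := fun K j hh => (h.pkgAtV3 hc γ hγ hγ1 K).T.Zterm j hh
  χ := fun K j W => (h.pkgAtV3 hc γ hγ hγ1 K).T.χ j W
  Estep := fun K i => (h.pkgAtV3 hc γ hγ hγ1 K).T.Estep i
  Ecst := fun K j => (h.pkgAtV3 hc γ hγ hγ1 K).T.Ecst j - (h.pkgAtV3 hc γ hγ hγ1 K).E
  Rm := fun K j => (h.pkgAtV3 hc γ hγ hγ1 K).T.Rm j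

section Delivered

variable (h : AlphaInputsT3AC.OfV3At F 𝔠 a₀ a₁) (hc : 0 < a₀ ∧ 0 < a₁ ∧ 𝔠.B₃ * a₁ ≤ a₀) (γ : ℝ) (hγ : 0 < γ)
  (hγ1 : γ ≤ (min 𝔠.gamma0 1) ^ 2) (π : AlphaInputsT3AC.PolymerT3 F)

/-- The majorant of the datum is the windowed pinned history sum: `up_j(W) = Σ_h wtP_j(h, W)·exp(−mainT_j(h,W) + Pint_j(h,W) + Zterm_j(h))`. [folklore] -/
theorem AlphaInputsT3AC.OfV3At.dataT3v3_up_eq (K j : ℕ) (W : GaugeField (F.P K) j (Matrix.specialUnitaryGroup (Fin 2) ℂ)) :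
    (h.dataT3v3 hc γ hγ hγ1 π).up K j W = ∑ r : Hist (F.P K) j, (h.pkgAtV3 hc γ hγ hγ1 K).wtP j r W *
      Real.exp (-((h.pkgAtV3 hc γ hγ hγ1 K).T.mainT j r W) + (h.pkgAtV3 hc γ hγ hγ1 K).T.Pint j r W + (h.pkgAtV3 hc γ hγ hγ1 K).T.Zterm j r) :=
  rfl

/-- The minorant of the datum is the tower's: `low_j(W) = χ_j(W)·exp(−mainT_j(triv,W) + Pint_j(triv,W))`. [folklore] -/
theorem AlphaInputsT3AC.OfV3At.dataT3v3_low_eq (K j : ℕ) (W : GaugeField (F.P K) j (Matrix.specialUnitaryGroup (Fin 2) ℂ)) :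
    (h.dataT3v3 hc γ hγ hγ1 π).low K j W = (h.pkgAtV3 hc γ hγ hγ1 K).T.χ j W *
      Real.exp (-((h.pkgAtV3 hc γ hγ hγ1 K).T.mainT j (Hist.triv (F.P K) j) W) + (h.pkgAtV3 hc γ hγ hγ1 K).T.Pint j (Hist.triv (F.P K) j) W) :=
  rfl

/-! ## §2 The minimiser rows delivered -/

/-- **`Constraint42Top` — PROVED from r2**. [cite: Balaban1985UV3, (42) p.266 and (67) p.273] -/
theorem AlphaInputsT3AC.OfV3At.dataT3v3_constraint42Top : Constraint42Top (h.dataT3v3 hc γ hγ hγ1 π) :=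
  fun K j hh W hj hadm b hb => (h.pkgAtV3 hc γ hγ hγ1 K).constraint42 j hj hh W hadm b hb

/-- **`Regularity68Levels` — PROVED from r3**. [cite: Balaban1985UV3, (68) p.273] -/
theorem AlphaInputsT3AC.OfV3At.dataT3v3_regularity68Levels : Regularity68Levels (h.dataT3v3 hc γ hγ hγ1 π) 𝔠.b₀ 𝔠.p₀ 𝔠.C68 :=
  fun K j hh W hj hadm i hi s hs q hq => (h.pkgAtV3 hc γ hγ hγ1 K).regularity68Levels j hj hh W hadm i hi s hs q hq

/-- **`Regularity68`** (the `s = 0` instance). [cite: Balaban1985UV3, (68) p.273] -/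
theorem AlphaInputsT3AC.OfV3At.dataT3v3_regularity68 : Regularity68 (h.dataT3v3 hc γ hγ hγ1 π) 𝔠.b₀ 𝔠.p₀ 𝔠.C68 :=
  regularity68_of_levels (h.dataT3v3_regularity68Levels hc γ hγ hγ1 π)

/-- **`MainTermIsAction`** — EXACT. [cite: Balaban1985UV3, (5) p.256 and (41) p.266] -/
theorem AlphaInputsT3AC.OfV3At.dataT3v3_mainTermIsAction : MainTermIsAction (h.dataT3v3 hc γ hγ hγ1 π) :=
  fun K j hh W => (h.pkgAtV3 hc γ hγ hγ1 K).mainT_eq j hh W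

/-- **THE `UminTrivIsRegMinimiser` CLAUSES AT A HEIGHT `n < K` — PROVED from r1** under the [7] bookkeeping `θBal(n) ≤ a₁`, `B₃θBal(n) ≤ ε₀ ≤ a₀`.
[cite: Balaban1985Variational, Thm 1 (8) p.279 and Prop 7 p.299] -/
theorem AlphaInputsT3AC.OfV3At.dataT3v3_uminTriv (K n : ℕ) (hnK : n < K) (ε₀ : ℝ)
    (ha₁ : θBal F.L γ 𝔠.b₀ 𝔠.p₀ n ≤ a₁) (hlo : 𝔠.B₃ * θBal F.L γ 𝔠.b₀ 𝔠.p₀ n ≤ ε₀) (hhi : ε₀ ≤ a₀)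
    (V : GaugeField (F.P n) 0 (Matrix.specialUnitaryGroup (Fin 2) ℂ)) (hV : PlaqSmall (θBal F.L γ 𝔠.b₀ 𝔠.p₀ n) V) :
    (h.dataT3v3 hc γ hγ hγ1 π).Umin K (K - n) ((h.dataT3v3 hc γ hγ hγ1 π).triv K (K - n))
        (fieldShift (F.sitesPerDir_eq (m := F.m) (K := K) (j := K - n) (m' := F.m) (K' := n) (j' := 0) (by omega)) V) ∈
      regFibrePr F n K hnK.le ε₀ V ∧
    wilsonAction4 ((h.dataT3v3 hc γ hγ hγ1 π).Umin K (K - n) ((h.dataT3v3 hc γ hγ hγ1 π).triv K (K - n))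
        (fieldShift (F.sitesPerDir_eq (m := F.m) (K := K) (j := K - n) (m' := F.m) (K' := n) (j' := 0) (by omega)) V)) =
      minActionRegPr F n K hnK.le ε₀ V := by
  have hθ : 0 < θBal F.L γ 𝔠.b₀ 𝔠.p₀ n := by
    have := (h.pkgAtV3 hc γ hγ hγ1 K).θBal_pos (K - n) (by omega)
    rwa [show K - (K - n) = n by omega] at this
  have ha₁' : θBal F.L γ 𝔠.b₀ 𝔠.p₀ n ≤ (h.pkgAtV3 hc γ hγ hγ1 K).a₁ := by rw [h.pkgAtV3_a₁ hc]; exact ha₁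
  have hhi' : ε₀ ≤ (h.pkgAtV3 hc γ hγ hγ1 K).a₀ := by rw [h.pkgAtV3_a₀ hc]; exact hhi
  exact ⟨(h.pkgAtV3 hc γ hγ hγ1 K).uminTriv_mem_regFibrePr hnK hθ ha₁' hlo hhi' V hV,
    (h.pkgAtV3 hc γ hγ hγ1 K).uminTriv_action_eq hnK hθ ha₁' hlo hhi' V hV⟩

/-- **`AdmOnSmall` AT THE RECORD'S `b₀, p₀` — PROVED** (`OfV2At.dataT3c_admOnSmall`'s proof). [cite: Balaban1985UV3, (40) p.266 and (47) p.267] -/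
theorem AlphaInputsT3AC.OfV3At.dataT3v3_admOnSmall : AdmOnSmall (h.dataT3v3 hc γ hγ hγ1 π) 𝔠.b₀ 𝔠.p₀ := by
  intro K j W _ hW
  refine ⟨Hist.admissible_triv _ _ j, fun p _ => (hW p).trans_le ?_⟩
  have hγ1' : γ ≤ 1 := hγ1.trans (sq_min_one_le _ 𝔠.gamma0_pos)
  have hmono := θBal_le_two_mul_sq_mul_θBal_succ (le_of_lt F.hL.2) hγ hγ1' 𝔠.b₀_pos 𝔠.p₀_pos.le (K - j)
  have hθ : 0 ≤ θBal F.L γ 𝔠.b₀ 𝔠.p₀ (K - j + 1) :=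
    (T3MinimiserStabilityReduction.θBal_pos (le_of_lt F.hL.2) hγ hγ1' 𝔠.b₀_pos 𝔠.p₀ (K - j + 1)).le
  have hB : 1 ≤ avgWindowFactor F.L := by
    unfold avgWindowFactor
    have hL : (1 : ℝ) ≤ F.L := by exact_mod_cast (le_of_lt F.hL.2)
    have h5 : (0 : ℝ) ≤ (((3 + 2) * F.L : ℕ) : ℝ) ^ 2 := sq_nonneg _
    nlinarith
  have hL2 : (0 : ℝ) ≤ 2 * (F.L : ℝ) ^ 2 := by positivity
  calc θBal F.L γ 𝔠.b₀ 𝔠.p₀ (K - j) ≤ 2 * (F.L : ℝ) ^ 2 * θBal F.L γ 𝔠.b₀ 𝔠.p₀ (K - j + 1) := hmono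
    _ = 2 * (F.L : ℝ) ^ 2 * 1 * θBal F.L γ 𝔠.b₀ 𝔠.p₀ (K - j + 1) := by ring
    _ ≤ 2 * (F.L : ℝ) ^ 2 * avgWindowFactor F.L * θBal F.L γ 𝔠.b₀ 𝔠.p₀ (K - j + 1) :=
        mul_le_mul_of_nonneg_right (mul_le_mul_of_nonneg_left hB hL2) hθ

/-! ## §3 The sandwich, the characteristic function, the sizes, the bookkeeping -/

/-- **(41)′ a.e., every `j ≤ K`, WITH THE WINDOWED PINNED HISTORY SUM** (`PkgAtV3.resDensity_le_sum_ae`; from the v3 rows alone). [cite: Balaban1985UV3, (41) p.266 and Thm 2 p.272] -/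
theorem AlphaInputsT3AC.OfV3At.dataT3v3_ineq41AE (K j : ℕ) (hj : j ≤ K) : Ineq41AE (h.dataT3v3 hc γ hγ hγ1 π) K j :=
  (h.pkgAtV3 hc γ hγ hγ1 K).resDensity_le_sum_ae j hj

/-- **(47)′ a.e., every `j ≤ K`** (`PkgAtV3.le_resDensity_ae`). [cite: Balaban1985UV3, (47) p.267 and Thm 2 p.272] -/
theorem AlphaInputsT3AC.OfV3At.dataT3v3_ineq47AE (K j : ℕ) (hj : j ≤ K) : Ineq47AE (h.dataT3v3 hc γ hγ hγ1 π) K j :=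
  (h.pkgAtV3 hc γ hγ hγ1 K).le_resDensity_ae j hj

/-- **`ChiRange`**. [cite: Balaban1985UV3, (47) p.267] -/
theorem AlphaInputsT3AC.OfV3At.dataT3v3_chiRange : ChiRange (h.dataT3v3 hc γ hγ hγ1 π) := fun K j W =>
  ⟨chi_towerOfAC_nonneg 𝔠.lane (h.pkgAtV3 hc γ hγ hγ1 K).X (h.pkgAtV3 hc γ hγ hγ1 K).𝔖 j W,
    chi_towerOfAC_le_one 𝔠.lane (h.pkgAtV3 hc γ hγ hγ1 K).X (h.pkgAtV3 hc γ hγ hγ1 K).𝔖 j W⟩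

/-- The majorant is nonnegative: `0 ≤ up_j(W)`. [folklore] -/
theorem AlphaInputsT3AC.OfV3At.dataT3v3_up_nonneg (K j : ℕ) (W : GaugeField (F.P K) j (Matrix.specialUnitaryGroup (Fin 2) ℂ)) :
    0 ≤ (h.dataT3v3 hc γ hγ hγ1 π).up K j W :=
  Finset.sum_nonneg fun r _ => mul_nonneg
    (PinnedStep.wtP_nonneg_le 𝔠.lane (h.pkgAtV3 hc γ hγ hγ1 K).X (AlphaInputsT3AC.admWindowT3 F 𝔠 γ hγ hγ1 K) j r W).1 (Real.exp_pos _).le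

/-- **`TrivRegions`** (`Carriers.Omega_triv`). [cite: Balaban1985UV3, (47) p.267 and p.272] -/
theorem AlphaInputsT3AC.OfV3At.dataT3v3_trivRegions : TrivRegions (h.dataT3v3 hc γ hγ hγ1 π) := fun _ j i =>
  Omega_triv _ _ j i

/-- **The `EcstBook` identity**: `Ecst K j = −Σ_{i<j} Estep K i` for `j ≤ K`. [cite: Balaban1985UV3, (62) p.271 and (64) p.273] -/
theorem AlphaInputsT3AC.OfV3At.dataT3v3_Ecst_eq (K j : ℕ) (hj : j ≤ K) :
    (h.dataT3v3 hc γ hγ hγ1 π).Ecst K j = -∑ i ∈ Finset.range j, (h.dataT3v3 hc γ hγ hγ1 π).Estep K i :=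
  (h.pkgAtV3 hc γ hγ hγ1 K).Ecst_sub_E_eq j hj

/-- **`RmSize`** with `C = r⋆γ^{3+κ₀}`, `q = L^{−κ₀}` (closed form `PkgAtV3.Rm_eq`): extensive in the PHYSICAL volume only, uniform in the cut-off.
[cite: Balaban1985UV3, (41) p.266 and (5) p.256] -/
theorem AlphaInputsT3AC.OfV3At.dataT3v3_rmSize :
    RmSize (h.dataT3v3 hc γ hγ hγ1 π) (𝔠.stepConsts.rstar * γ ^ (3 + 𝔠.κ₀)) (((F.L : ℝ)⁻¹) ^ 𝔠.κ₀) := by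
  have hL1 : (1 : ℝ) < F.L := by exact_mod_cast F.hL.2
  have hLi : (0 : ℝ) ≤ (F.L : ℝ)⁻¹ := inv_nonneg.mpr (zero_lt_one.trans hL1).le
  have hq0 : 0 ≤ ((F.L : ℝ)⁻¹) ^ 𝔠.κ₀ := Real.rpow_nonneg hLi _
  refine ⟨hq0, Real.rpow_lt_one hLi (inv_lt_one_of_one_lt₀ hL1) 𝔠.κ₀_pos, fun K j hj => ?_⟩
  have heq : (h.dataT3v3 hc γ hγ hγ1 π).Rm K j = 𝔠.stepConsts.rstar * γ ^ (3 + 𝔠.κ₀) *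
      (∑ i ∈ Finset.range j, (((F.L : ℝ)⁻¹) ^ 𝔠.κ₀) ^ (K - i)) * (2 * (F.L : ℝ) ^ F.m) ^ 3 :=
    (h.pkgAtV3 hc γ hγ hγ1 K).Rm_eq j hj
  refine ⟨?_, heq.le⟩
  rw [heq]
  have h3 : 0 ≤ ∑ i ∈ Finset.range j, (((F.L : ℝ)⁻¹) ^ 𝔠.κ₀) ^ (K - i) := Finset.sum_nonneg fun i _ => pow_nonneg hq0 _
  have h4 : 0 ≤ (2 * (F.L : ℝ) ^ F.m) ^ 3 := by positivity
  exact mul_nonneg (mul_nonneg (mul_nonneg 𝔠.stepConsts.rstar_nonneg (Real.rpow_nonneg hγ.le _)) h3) h4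

/-- **`χ_j` IS THE INDICATOR OF THE ROUTE'S WINDOW**: `χ^{(K)}_j = chiSmall univ (θBal (K − j))`, `j ≤ K`. [cite: Balaban1985UV3, (47) p.267] -/
theorem AlphaInputsT3AC.OfV3At.dataT3v3_chi_eq (K j : ℕ) (hj : j ≤ K) (W : GaugeField (F.P K) j (Matrix.specialUnitaryGroup (Fin 2) ℂ)) :
    (h.dataT3v3 hc γ hγ hγ1 π).χ K j W = chiSmall Set.univ (θBal F.L γ 𝔠.b₀ 𝔠.p₀ (K - j)) W := by
  rw [← (h.pkgAtV3 hc γ hγ hγ1 K).eps1_eq j hj]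
  rfl

/-- **`NoTrivOnLarge` clause 1 with `Cχ = 1`**: one plaquette at distance `≥ θBal(K − j)` from `1` kills `χ_j`. [cite: Balaban1985UV3, (47) p.267] -/
theorem AlphaInputsT3AC.OfV3At.dataT3v3_chi_eq_zero_of_le (K j : ℕ) (hj : j ≤ K)
    (W : GaugeField (F.P K) j (Matrix.specialUnitaryGroup (Fin 2) ℂ)) (q : Plaq (F.P K) j)
    (hq : 1 * θBal F.L γ 𝔠.b₀ 𝔠.p₀ (K - j) ≤ GaugeGroup.dist1 (GaugeField.plaqHol W q)) :
    (h.dataT3v3 hc γ hγ hγ1 π).χ K j W = 0 := by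
  rw [h.dataT3v3_chi_eq hc γ hγ hγ1 π K j hj W]
  unfold chiSmall
  rw [if_neg]
  intro hsmall
  have hlt := hsmall q (Set.mem_univ q)
  linarith

/-- `χ_j(W) = 1` on the window. [cite: Balaban1985UV3, (47) p.267] -/
theorem AlphaInputsT3AC.OfV3At.dataT3v3_chi_eq_one_of_plaqSmall (K j : ℕ) (hj : j ≤ K)
    (W : GaugeField (F.P K) j (Matrix.specialUnitaryGroup (Fin 2) ℂ)) (hW : PlaqSmall (θBal F.L γ 𝔠.b₀ 𝔠.p₀ (K - j)) W) :
    (h.dataT3v3 hc γ hγ hγ1 π).χ K j W = 1 := by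
  rw [h.dataT3v3_chi_eq hc γ hγ hγ1 π K j hj W]
  unfold chiSmall
  rw [if_pos (show PlaqSmallOn Set.univ (θBal F.L γ 𝔠.b₀ 𝔠.p₀ (K - j)) W from fun q _ => hW q)]

/-- On the window the minorant is positive: `0 < low_j(W)` for `θBal(K − j)`-small `W`. [cite: Balaban1985UV3, (47) p.267] -/
theorem AlphaInputsT3AC.OfV3At.dataT3v3_low_pos_of_plaqSmall (K j : ℕ) (hj : j ≤ K)
    (W : GaugeField (F.P K) j (Matrix.specialUnitaryGroup (Fin 2) ℂ)) (hW : PlaqSmall (θBal F.L γ 𝔠.b₀ 𝔠.p₀ (K - j)) W) :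
    0 < (h.dataT3v3 hc γ hγ hγ1 π).low K j W := by
  unfold AlphaDataT3.low
  rw [h.dataT3v3_chi_eq_one_of_plaqSmall hc γ hγ hγ1 π K j hj W hW, one_mul]
  exact Real.exp_pos _

/-! ## §4 `EnvelopeRegular` at every `j ≤ K` -/

/-- **`up_j` integrable, every `j ≤ K`** (the windowed pinned weights are integrable with `∫ ≤ 1`; the data rows at level `j`: steps below the top, terminal rows at
the top). [cite: Balaban1985UV3, (41) p.266] -/
theorem AlphaInputsT3AC.OfV3At.dataT3v3_integrable_up (K j : ℕ) (hj : j ≤ K) :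
    Integrable ((h.dataT3v3 hc γ hγ hγ1 π).up K j) (fieldMeasure (F.P K) j (Matrix.specialUnitaryGroup (Fin 2) ℂ)) := by
  have hmain : ∀ (hh : Hist (F.P K) j) (W : GaugeField (F.P K) j (Matrix.specialUnitaryGroup (Fin 2) ℂ)), (h.pkgAtV3 hc γ hγ hγ1 K).T.mainT j hh W =
      ((T3Scales F γ hγ (hγ1.trans (sq_min_one_le _ 𝔠.gamma0_pos)) K).gk j)⁻¹ ^ 2 *
        (T3Scales F γ hγ (hγ1.trans (sq_min_one_le _ 𝔠.gamma0_pos)) K).actionEta j ((h.pkgAtV3 hc γ hγ hγ1 K).UkH j hh W) := fun _ _ => rfl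
  have hfun : (h.dataT3v3 hc γ hγ hγ1 π).up K j = fun W => ∑ r : Hist (F.P K) j, (h.pkgAtV3 hc γ hγ hγ1 K).wtP j r W *
      Real.exp (-((h.pkgAtV3 hc γ hγ hγ1 K).T.mainT j r W) + (h.pkgAtV3 hc γ hγ hγ1 K).T.Pint j r W + (h.pkgAtV3 hc γ hγ hγ1 K).T.Zterm j r) :=
    funext fun W => h.dataT3v3_up_eq hc γ hγ hγ1 π K j W
  rw [hfun]
  refine integrable_finsetSum _ fun hh _ => ?_
  refine integrable_mul_exp_of_le (PinnedStep.integrable_wtP_and_integral_le 𝔠.lane (h.pkgAtV3 hc γ hγ hγ1 K).X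
    (AlphaInputsT3AC.admWindowT3 F 𝔠 γ hγ hγ1 K) (AlphaInputsT3AC.measurableSet_admWindowT3 F 𝔠 γ hγ hγ1 K) j hh).1 ?_
    (c := (h.pkgAtV3 hc γ hγ hγ1 K).𝔄.cP j + (h.pkgAtV3 hc γ hγ hγ1 K).T.Zterm j hh) ?_
  · simp_rw [hmain]
    exact ((measurable_const.mul ((Bound55Std.measurable_actionEta
      (S := T3Scales F γ hγ (hγ1.trans (sq_min_one_le _ 𝔠.gamma0_pos)) K) j).comp ((h.pkgAtV3 hc γ hγ hγ1 K).measurable_UkH j hj hh))).neg.add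
      ((h.pkgAtV3 hc γ hγ hγ1 K).measurable_Pint j hj hh)).add measurable_const
  · intro W
    have h0 : 0 ≤ (h.pkgAtV3 hc γ hγ hγ1 K).T.mainT j hh W := by
      rw [hmain]
      exact mul_nonneg (sq_nonneg _) (Bound55Std.actionEta_nonneg (S := T3Scales F γ hγ (hγ1.trans (sq_min_one_le _ 𝔠.gamma0_pos)) K) j _)
    have h1 : (h.pkgAtV3 hc γ hγ hγ1 K).T.Pint j hh W ≤ (h.pkgAtV3 hc γ hγ hγ1 K).𝔄.cP j := (h.pkgAtV3 hc γ hγ hγ1 K).Pint_le j hj hh W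
    linarith

/-- **`low_j` integrable, every `j ≤ K`** (`PkgAt.integrable_low_of_rows`' proof at the v3 record). [cite: Balaban1985UV3, (47) p.267] -/
theorem AlphaInputsT3AC.OfV3At.dataT3v3_integrable_low (K j : ℕ) (hj : j ≤ K) :
    Integrable ((h.dataT3v3 hc γ hγ hγ1 π).low K j) (fieldMeasure (F.P K) j (Matrix.specialUnitaryGroup (Fin 2) ℂ)) := by
  have hchi : (h.pkgAtV3 hc γ hγ hγ1 K).T.χ j = chiSmall Set.univ ((inputOfAC 𝔠.lane (h.pkgAtV3 hc γ hγ hγ1 K).X (h.pkgAtV3 hc γ hγ hγ1 K).𝔖).ε₁ j) := rfl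
  have hmain : ∀ W : GaugeField (F.P K) j (Matrix.specialUnitaryGroup (Fin 2) ℂ), (h.pkgAtV3 hc γ hγ hγ1 K).T.mainT j (Hist.triv (F.P K) j) W =
      ((T3Scales F γ hγ (hγ1.trans (sq_min_one_le _ 𝔠.gamma0_pos)) K).gk j)⁻¹ ^ 2 *
        (T3Scales F γ hγ (hγ1.trans (sq_min_one_le _ 𝔠.gamma0_pos)) K).actionEta j ((h.pkgAtV3 hc γ hγ hγ1 K).UkH j (Hist.triv (F.P K) j) W) :=
    fun _ => rfl
  show Integrable (fun W => (h.pkgAtV3 hc γ hγ hγ1 K).T.χ j W *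
    Real.exp (-((h.pkgAtV3 hc γ hγ hγ1 K).T.mainT j (Hist.triv (F.P K) j) W) + (h.pkgAtV3 hc γ hγ hγ1 K).T.Pint j (Hist.triv (F.P K) j) W)) _
  refine Balaban3D.Proofs.Transport48.integrable_weight_mul_exp ?_ ?_ ?_ ?_ (c := (h.pkgAtV3 hc γ hγ hγ1 K).𝔄.cP j) ?_
  · rw [hchi]; exact T4AxialGaugeFixing.measurable_chiSmall _ _
  · intro W; rw [hchi]; unfold chiSmall; split_ifs <;> norm_num
  · intro W; rw [hchi]; unfold chiSmall; split_ifs <;> norm_num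
  · simp_rw [hmain]
    exact (measurable_const.mul ((Bound55Std.measurable_actionEta
      (S := T3Scales F γ hγ (hγ1.trans (sq_min_one_le _ 𝔠.gamma0_pos)) K) j).comp ((h.pkgAtV3 hc γ hγ hγ1 K).measurable_UkH j hj _))).neg.add
      ((h.pkgAtV3 hc γ hγ hγ1 K).measurable_Pint j hj _)
  · intro W
    have h0 : 0 ≤ (h.pkgAtV3 hc γ hγ hγ1 K).T.mainT j (Hist.triv (F.P K) j) W := by
      rw [hmain]
      exact mul_nonneg (sq_nonneg _) (Bound55Std.actionEta_nonneg (S := T3Scales F γ hγ (hγ1.trans (sq_min_one_le _ 𝔠.gamma0_pos)) K) j _)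
    have h1 : (h.pkgAtV3 hc γ hγ hγ1 K).T.Pint j (Hist.triv (F.P K) j) W ≤ (h.pkgAtV3 hc γ hγ hγ1 K).𝔄.cP j :=
      (h.pkgAtV3 hc γ hγ hγ1 K).Pint_le j hj _ W
    linarith

/-- **`0 < ∫ low_j`, every `j ≤ K`**. [cite: Balaban1985UV3, (47) p.267] -/
theorem AlphaInputsT3AC.OfV3At.dataT3v3_integral_low_pos (K j : ℕ) (hj : j ≤ K) :
    0 < ∫ W, (h.dataT3v3 hc γ hγ hγ1 π).low K j W ∂fieldMeasure (F.P K) j (Matrix.specialUnitaryGroup (Fin 2) ℂ) := by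
  have hχ := h.dataT3v3_chiRange hc γ hγ hγ1 π
  rw [integral_pos_iff_support_of_nonneg_ae (ae_of_all _ fun W => low_nonneg hχ K j W) (h.dataT3v3_integrable_low hc γ hγ hγ1 π K j hj)]
  have hθ : 0 < θBal F.L γ 𝔠.b₀ 𝔠.p₀ (K - j) := (h.pkgAtV3 hc γ hγ hγ1 K).θBal_pos j hj
  refine lt_of_lt_of_le (fieldMeasure_plaqSmall_pos (P := F.P K) (j := j) hθ) (measure_mono fun W hW => ?_)
  exact Function.mem_support.mpr (ne_of_gt (h.dataT3v3_low_pos_of_plaqSmall hc γ hγ hγ1 π K j hj W hW))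

/-- **`EnvelopeRegular` AT EVERY LEVEL `j ≤ K`**. [cite: Balaban1985UV3, (41) p.266 and (47) p.267] -/
theorem AlphaInputsT3AC.OfV3At.dataT3v3_envelopeRegular (K j : ℕ) (hj : j ≤ K) : EnvelopeRegular (h.dataT3v3 hc γ hγ hγ1 π) K j :=
  ⟨h.dataT3v3_integrable_low hc γ hγ hγ1 π K j hj, h.dataT3v3_integrable_up hc γ hγ hγ1 π K j hj, h.dataT3v3_integral_low_pos hc γ hγ hγ1 π K j hj⟩

/-- **THE PACKAGE'S SANDWICH-AND-REGULARITY CLAUSE IN FULL**: `∀ K j, j ≤ K → Ineq41AE ∧ Ineq47AE ∧ EnvelopeRegular` for the v3 datum. [cite: Balaban1985UV3, Thm 2 p.272] -/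
theorem AlphaInputsT3AC.OfV3At.dataT3v3_sandwich_regular (K j : ℕ) (hj : j ≤ K) :
    Ineq41AE (h.dataT3v3 hc γ hγ hγ1 π) K j ∧ Ineq47AE (h.dataT3v3 hc γ hγ hγ1 π) K j ∧ EnvelopeRegular (h.dataT3v3 hc γ hγ hγ1 π) K j :=
  ⟨h.dataT3v3_ineq41AE hc γ hγ hγ1 π K j hj, h.dataT3v3_ineq47AE hc γ hγ hγ1 π K j hj, h.dataT3v3_envelopeRegular hc γ hγ hγ1 π K j hj⟩

end Delivered

end Summit.QuantumFields.YangMills.Theorems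

end
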